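import Literature.AlgebraicGeometry.Resolution.BlowupAlgebraStrictTransform
import Literature.AlgebraicGeometry.Resolution.BlowupAlgebraPresentation
import Literature.AlgebraicGeometry.Resolution.SymbolicPowersRsop
import HarnessLib

/-!
# `EquisingularLiftNat`, line `sections`, stub `stub_elnat_three` — helper H-CONE:
# the exceptional line of a doubled-plane tangent cone lies on the strict transform

[OURS · L1 W4.5b] Helper statement H-CONE `exceptionalLine_subset_strictTransform_of_doubledPlaneCone`
of CRUX-PLAN v3 §1.7 / §4 (chain w45b, crux item `EquisingularLiftNat` = stmt-ResolutionOfSingularities-20038,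
research stub `stub_elnat_three` of the registered line `sections`); NOT a statement of any manuscript.
It is the E1 prerequisite of the COMB centres `Z = Z₀ + Σ e_j` of CRUX-PLAN v3 §1.7: the exceptional
curve `e_j` of an earlier point blow-up may be used inside a centre only if it lies on the current reduced
strict transform `H_i`, and it does as soon as the tangent cone of `H_{i-1}` at the blown-up point `q_j` is
the carrier plane DOUBLED.

CHART ALGEBRA (everything below is proved for an arbitrary commutative ring). Let `R` be a ring
(`𝒪_{P,q}` or an affine coordinate ring), `I ⊆ R` the ideal of the centre (the point `q`), `e ∈ I` (the
carrier plane `{e = 0}`), `F ∈ R` the equation of the hypersurface `H`, and suppose the TANGENT CONE IS THE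
DOUBLED PLANE: `F - u·e² ∈ I³` for some `u ∈ R`. On the chart `Spec R[I/b]` (`b ∈ I`; the affine blowup
algebra `blowupAlgebra I b ⊆ R[1/b]` of `Literature/AlgebraicGeometry/Resolution/AffineBlowupAlgebra.lean`)
the exceptional divisor is `E = V(b)` and the exceptional line of the carrier is `e_j = V(b, e/b)`. Then:

* `exists_controlledTransform_doubledPlaneCone` — `F = b² · F′` in `R[I/b]` with `F′ - u·(e/b)² ∈ (b)`
  (`F′ = u (e/b)² + b · (F - u e²)/b³`); `F′` is unique (`b` is a non-zero-divisor of `R[I/b]`,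
  `controlledTransform_unique`), so every `F′` with `F = b² F′` satisfies `F′ - u (e/b)² ∈ (b)`
  (`controlledTransform_sub_mem_span`);
* `exceptionalLine_le_controlledTransform` — hence `(F′) ⊆ (e/b, b)`: **`e_j ∩ chart ⊆ V(F′)`**;
* `controlledTransform_sup_exceptional_eq` — if `u` is a unit, `(F′, b) = ((e/b)², b)`: the trace of
  `V(F′)` on `E` is the DOUBLED line `2 e_j` («`H_i ∩ E_j = 2 e_j`»);
* `controlledTransform_chart_self` — on the chart `b = e` one has `F′ - u ∈ (e)`, so for `u` a unit
  `(F′, e) = R[I/e]`: the strict transform does not meet `E` there (and `e_j` misses that chart);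
* `not_dvd_controlledTransform`, `ker_mapQuotient_eq_span_controlledTransform`,
  `exceptionalLine_subset_strictTransform_of_doubledPlaneCone` — for a centre `I = (x₁, …, x_r)` given by a
  QUASI-REGULAR sequence with `R/I` a domain (e.g. the maximal ideal of a regular local ring with a regular
  system of parameters, Matsumura Thm. 16.2 (i)), `b = xᵢ`, `e = x_j`, `j ≠ i`, and `u ∉ I`: `b ∤ F′`
  (modulo `b` the chart ring is the polynomial ring `(R/I)[T_l : l ≠ i]`, Stacks 0BIQ, and `F′ ↦ ū T_j²
  ≠ 0`), so `(F′)` IS the kernel of the chart map `R[I/b] → (R/(F))[Ī/b̄]` onto the chart ring of the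
  blow-up of the hypersurface `R/(F)` (`blowupAlgebra.ker_mapQuotient_eq_span`: `V(F′)` is the STRICT
  transform, not only the controlled one), and therefore **the exceptional line `V(b, e/b)` lies on the
  strict transform of `V(F)`**: `ker ⊆ (e/b, b)`.

Geometric reading (CRUX-PLAN v3 §1.7, by hand there, kernel-checked here on the charts): `R = 𝒪_{P_{i-1,k},q_j}`
regular local of dimension 3 with regular parameters `(x, y, e)`, `{e = 0}` the special fibre of the
`O`-smooth carrier `S̃` through `q_j`, `H_{i-1} = V(F)` with `F ≡ g(q_j)·e² (mod 𝔪³)`, `g(q_j) ≠ 0`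
(shape `l² + e·l·f + e²·g`, `l ∈ 𝔪²`); the blow-up of `q_j` has exceptional plane `E_j = ℙ(T_{q_j}P_k)`,
the carrier's exceptional curve is the line `e_j = ℙ(T_{q_j}S̃_k) = V(e/b) ⊂ E_j`, and the three charts
`b ∈ {x, y, e}` cover the blow-up; on `b = x, y` the line `e_j` lies on `St(H_{i-1}) = H_i` with
`H_i · E_j = 2 e_j`, on `b = e` neither `e_j` nor `H_i ∩ E_j` appears. All statements [folklore]-level
commutative algebra; axioms standard.
-/

set_option linter.dupNamespace false -- mandated namespace `Summit.<Summit>.<Problem>` of this single-conjunct summit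

noncomputable section

namespace Summit.ResolutionOfSingularities.ResolutionOfSingularities.Cruxes.EquisingularLiftNat.Sections

open IsLocalization Literature.AlgebraicGeometry.Resolution

universe u

variable {R : Type u} [CommRing R]

/-! ## The controlled transform `F′ = F/b²` of a doubled-plane cone on the chart `R[I/b]` -/

/-- **The controlled transform of a doubled-plane cone.** If `e ∈ I` and `F - u·e² ∈ I³`, then on the
chart `R[I/b]` of the blow-up along `I` one has `F = b²·F′` with `F′ - u·(e/b)² ∈ (b)`
(namely `F′ = u (e/b)² + b·((F - u e²)/b³)`). [folklore] -/
theorem exists_controlledTransform_doubledPlaneCone (I : Ideal R) (b : R) {e u F : R} (he : e ∈ I)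
    (hF : F - u * e ^ 2 ∈ I ^ 3) :
    ∃ F' : blowupAlgebra I b,
      algebraMap R (blowupAlgebra I b) F = algebraMap R (blowupAlgebra I b) b ^ 2 * F' ∧
      F' - algebraMap R (blowupAlgebra I b) u * blowupAlgebra.gen I b e he ^ 2 ∈
        Ideal.span {algebraMap R (blowupAlgebra I b) b} := by
  -- `g := (F - u e²)/b³ ∈ R[I/b]`
  let g : blowupAlgebra I b :=
    ⟨algebraMap R (Localization.Away b) (F - u * e ^ 2) * Away.invSelf b ^ 3,
      algebraMap_mul_invSelf_pow_mem_blowupAlgebra (I := I) (a := b) 3 hF⟩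
  refine ⟨algebraMap R (blowupAlgebra I b) u * blowupAlgebra.gen I b e he ^ 2 +
      algebraMap R (blowupAlgebra I b) b * g, ?_, ?_⟩
  · -- check `F = b² (u (e/b)² + b g)` in `R[1/b]`
    apply Subtype.ext
    change algebraMap R (Localization.Away b) F =
      algebraMap R (Localization.Away b) b ^ 2 *
        (algebraMap R (Localization.Away b) u *
            (algebraMap R (Localization.Away b) e * Away.invSelf b) ^ 2 +
          algebraMap R (Localization.Away b) b *
            (algebraMap R (Localization.Away b) (F - u * e ^ 2) * Away.invSelf b ^ 3))
    have hb : algebraMap R (Localization.Away b) b * Away.invSelf b = 1 := Away.mul_invSelf b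
    have key : algebraMap R (Localization.Away b) b ^ 2 *
        (algebraMap R (Localization.Away b) u *
            (algebraMap R (Localization.Away b) e * Away.invSelf b) ^ 2 +
          algebraMap R (Localization.Away b) b *
            (algebraMap R (Localization.Away b) (F - u * e ^ 2) * Away.invSelf b ^ 3)) =
        (algebraMap R (Localization.Away b) b * Away.invSelf b) ^ 2 *
            (algebraMap R (Localization.Away b) u * algebraMap R (Localization.Away b) e ^ 2) +
          (algebraMap R (Localization.Away b) b * Away.invSelf b) ^ 3 *
            algebraMap R (Localization.Away b) (F - u * e ^ 2) := by
      ring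
    rw [key, hb, one_pow, one_pow, one_mul, one_mul, map_sub, map_mul, map_pow]
    ring
  · rw [add_sub_cancel_left]
    exact Ideal.mul_mem_right _ _ (Ideal.mem_span_singleton_self _)

/-- The controlled transform is unique: `b` is a non-zero-divisor of `R[I/b]`. [folklore] -/
theorem controlledTransform_unique (I : Ideal R) (b : R) {F : R} {n : ℕ} {F' F'' : blowupAlgebra I b}
    (h' : algebraMap R (blowupAlgebra I b) F = algebraMap R (blowupAlgebra I b) b ^ n * F')
    (h'' : algebraMap R (blowupAlgebra I b) F = algebraMap R (blowupAlgebra I b) b ^ n * F'') :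
    F' = F'' := by
  have hreg := pow_mem (algebraMap_mem_nonZeroDivisors_blowupAlgebra (I := I) (a := b)) n
  exact (mul_cancel_left_mem_nonZeroDivisors hreg).mp (h'.symm.trans h'')

/-- Every `F′` with `F = b² F′` on `R[I/b]` satisfies `F′ - u (e/b)² ∈ (b)` (doubled-plane cone
`F - u e² ∈ I³`). [folklore] -/
theorem controlledTransform_sub_mem_span (I : Ideal R) (b : R) {e u F : R} (he : e ∈ I)
    (hF : F - u * e ^ 2 ∈ I ^ 3) {F' : blowupAlgebra I b}
    (hF' : algebraMap R (blowupAlgebra I b) F = algebraMap R (blowupAlgebra I b) b ^ 2 * F') :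
    F' - algebraMap R (blowupAlgebra I b) u * blowupAlgebra.gen I b e he ^ 2 ∈
      Ideal.span {algebraMap R (blowupAlgebra I b) b} := by
  obtain ⟨F'', hF'', hmem⟩ := exists_controlledTransform_doubledPlaneCone I b he hF
  rwa [controlledTransform_unique I b hF' hF'']

/-- **`e_j ∩ chart ⊆ V(F′)`**: the controlled transform lies in the ideal `(e/b, b)` of the exceptional
line. [folklore] -/
theorem exceptionalLine_le_controlledTransform (I : Ideal R) (b : R) {e u F : R} (he : e ∈ I)
    (hF : F - u * e ^ 2 ∈ I ^ 3) {F' : blowupAlgebra I b}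
    (hF' : algebraMap R (blowupAlgebra I b) F = algebraMap R (blowupAlgebra I b) b ^ 2 * F') :
    Ideal.span {F'} ≤ Ideal.span {blowupAlgebra.gen I b e he, algebraMap R (blowupAlgebra I b) b} := by
  have h := controlledTransform_sub_mem_span I b he hF hF'
  obtain ⟨c, hc⟩ := Ideal.mem_span_singleton'.mp h
  rw [Ideal.span_singleton_le_iff_mem, Ideal.mem_span_pair]
  refine ⟨algebraMap R (blowupAlgebra I b) u * blowupAlgebra.gen I b e he, c, ?_⟩
  have hF'eq : F' = algebraMap R (blowupAlgebra I b) u * blowupAlgebra.gen I b e he ^ 2 +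
      c * algebraMap R (blowupAlgebra I b) b := by
    rw [hc]; ring
  rw [hF'eq]; ring

/-- **`H_i ∩ E_j = 2 e_j` on the chart**: if the cone coefficient `u` is a unit, the ideals `(F′, b)` and
`((e/b)², b)` of `R[I/b]` coincide. [folklore] -/
theorem controlledTransform_sup_exceptional_eq (I : Ideal R) (b : R) {e u F : R} (he : e ∈ I)
    (hu : IsUnit u) (hF : F - u * e ^ 2 ∈ I ^ 3) {F' : blowupAlgebra I b}
    (hF' : algebraMap R (blowupAlgebra I b) F = algebraMap R (blowupAlgebra I b) b ^ 2 * F') :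
    Ideal.span {F', algebraMap R (blowupAlgebra I b) b} =
      Ideal.span {blowupAlgebra.gen I b e he ^ 2, algebraMap R (blowupAlgebra I b) b} := by
  have h := controlledTransform_sub_mem_span I b he hF hF'
  obtain ⟨c, hc⟩ := Ideal.mem_span_singleton'.mp h
  -- `F' = u (e/b)² + c b`
  have hF'eq : F' = algebraMap R (blowupAlgebra I b) u * blowupAlgebra.gen I b e he ^ 2 +
      c * algebraMap R (blowupAlgebra I b) b := by
    rw [hc]; ring
  obtain ⟨v, hv⟩ := hu
  have huv : algebraMap R (blowupAlgebra I b) (↑v⁻¹ : R) * algebraMap R (blowupAlgebra I b) u = 1 := by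
    rw [← map_mul, ← hv, Units.inv_mul, map_one]
  apply le_antisymm
  · rw [Ideal.span_le, Set.insert_subset_iff, Set.singleton_subset_iff, SetLike.mem_coe,
      SetLike.mem_coe, Ideal.mem_span_pair, Ideal.mem_span_pair]
    exact ⟨⟨algebraMap R (blowupAlgebra I b) u, c, by rw [hF'eq]⟩, ⟨0, 1, by ring⟩⟩
  · rw [Ideal.span_le, Set.insert_subset_iff, Set.singleton_subset_iff, SetLike.mem_coe,
      SetLike.mem_coe, Ideal.mem_span_pair, Ideal.mem_span_pair]
    refine ⟨⟨algebraMap R (blowupAlgebra I b) (↑v⁻¹ : R),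
      -(algebraMap R (blowupAlgebra I b) (↑v⁻¹ : R) * c), ?_⟩, ⟨0, 1, by ring⟩⟩
    -- `(e/b)² = v⁻¹ F' - v⁻¹ c b`
    rw [hF'eq, mul_add, ← mul_assoc, huv, one_mul]
    ring

/-- **The chart `b = e`**: there `e/e = 1`, so `F′ - u ∈ (e)`; if `u` is a unit, `V(F′)` does not meet
the exceptional divisor `V(e)` on this chart: `(F′, e) = R[I/e]`. [folklore] -/
theorem controlledTransform_chart_self (I : Ideal R) {e u F : R} (he : e ∈ I)
    (hF : F - u * e ^ 2 ∈ I ^ 3) {F' : blowupAlgebra I e}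
    (hF' : algebraMap R (blowupAlgebra I e) F = algebraMap R (blowupAlgebra I e) e ^ 2 * F') :
    F' - algebraMap R (blowupAlgebra I e) u ∈ Ideal.span {algebraMap R (blowupAlgebra I e) e} ∧
      (IsUnit u → Ideal.span {F', algebraMap R (blowupAlgebra I e) e} = ⊤) := by
  have h := controlledTransform_sub_mem_span I e he hF hF'
  rw [blowupAlgebra.gen_self I e he, one_pow, mul_one] at h
  refine ⟨h, fun hu => ?_⟩
  obtain ⟨c, hc⟩ := Ideal.mem_span_singleton'.mp h
  obtain ⟨v, hv⟩ := hu
  have huv : algebraMap R (blowupAlgebra I e) (↑v⁻¹ : R) * algebraMap R (blowupAlgebra I e) u = 1 := by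
    rw [← map_mul, ← hv, Units.inv_mul, map_one]
  have hF'eq : F' = algebraMap R (blowupAlgebra I e) u + c * algebraMap R (blowupAlgebra I e) e := by
    rw [hc]; ring
  rw [Ideal.eq_top_iff_one, Ideal.mem_span_pair]
  refine ⟨algebraMap R (blowupAlgebra I e) (↑v⁻¹ : R),
    -(algebraMap R (blowupAlgebra I e) (↑v⁻¹ : R) * c), ?_⟩
  rw [hF'eq, mul_add, huv]
  ring

/-! ## Quasi-regular centres: `F′` is the strict transform, and `e_j ⊆ St(H)` -/

section QuasiRegular

variable {r : ℕ} (x : Fin r → R) (i j : Fin r)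

/-- **`b ∤ F′`** for a quasi-regular centre `I = (x₁, …, x_r)` with `R/I` a domain, `b = xᵢ`, `e = x_j`
(`j ≠ i`) and cone coefficient `u ∉ I`: modulo `(b)` the chart ring is the polynomial ring
`(R/I)[T_l : l ≠ i]` (Stacks 0BIQ) and `F′ ↦ ū·T_j² ≠ 0`. [cite: StacksProject, Tag 0BIQ] -/
theorem not_dvd_controlledTransform (hx : IsQuasiRegular x) (hji : j ≠ i) {u F : R}
    (hu : u ∉ Ideal.span (Set.range x))
    (hF : F - u * x j ^ 2 ∈ Ideal.span (Set.range x) ^ 3)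
    {F' : blowupAlgebra (Ideal.span (Set.range x)) (x i)}
    (hF' : algebraMap R _ F = algebraMap R _ (x i) ^ 2 * F') :
    ¬ algebraMap R (blowupAlgebra (Ideal.span (Set.range x)) (x i)) (x i) ∣ F' := by
  intro hdvd
  have h := controlledTransform_sub_mem_span (Ideal.span (Set.range x)) (x i)
    (blowupAlgebra.mem_span_range x j) hF hF'
  have hmem : algebraMap R _ u * blowupAlgebra.frac x i j ^ 2 ∈
      Ideal.span {algebraMap R (blowupAlgebra (Ideal.span (Set.range x)) (x i)) (x i)} := by
    have h2 : F' ∈ Ideal.span {algebraMap R (blowupAlgebra (Ideal.span (Set.range x)) (x i)) (x i)} :=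
      Ideal.mem_span_singleton.mpr hdvd
    have := Ideal.sub_mem _ h2 h
    rwa [sub_sub_cancel] at this
  -- `u (x_j/x_i)² = eval (C u * T_j²)`
  have heval : blowupAlgebra.eval x i (MvPolynomial.C u * MvPolynomial.X ⟨j, hji⟩ ^ 2) =
      algebraMap R _ u * blowupAlgebra.frac x i j ^ 2 := by
    rw [map_mul, map_pow, blowupAlgebra.eval_C, blowupAlgebra.eval_X]
  rw [← heval, blowupAlgebra.eval_mem_span_algebraMap_iff x i hx] at hmem
  have hc := hmem (Finsupp.single ⟨j, hji⟩ 2)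
  rw [MvPolynomial.coeff_C_mul, MvPolynomial.coeff_X_pow, if_pos rfl, mul_one] at hc
  exact hu hc

/-- `xᵢ` is a prime element of `R[I/xᵢ]` for `x` quasi-regular with `R/I` a domain
(`blowupAlgebra.isPrime_span_algebraMap`). [cite: StacksProject, Tag 0BIQ] -/
theorem prime_algebraMap_of_isQuasiRegular (hx : IsQuasiRegular x)
    [IsDomain (R ⧸ Ideal.span (Set.range x))] :
    Prime (algebraMap R (blowupAlgebra (Ideal.span (Set.range x)) (x i)) (x i)) := by
  have hP := blowupAlgebra.isPrime_span_algebraMap x i hx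
  have hnt : Nontrivial (blowupAlgebra (Ideal.span (Set.range x)) (x i)) :=
    ⟨⟨0, 1, fun h01 => hP.ne_top ((Ideal.eq_top_iff_one _).mpr (h01 ▸ Ideal.zero_mem _))⟩⟩
  have hne : algebraMap R (blowupAlgebra (Ideal.span (Set.range x)) (x i)) (x i) ≠ 0 :=
    nonZeroDivisors.ne_zero (algebraMap_mem_nonZeroDivisors_blowupAlgebra (I := Ideal.span (Set.range x))
      (a := x i))
  exact (Ideal.span_singleton_prime hne).mp hP

/-- **`V(F′)` is the strict transform**: for `x` quasi-regular, `R/I` a domain, `j ≠ i`, `u ∉ I` and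
`F - u x_j² ∈ I³`, the kernel of the chart map `R[I/xᵢ] → (R/(F))[Ī/x̄ᵢ]` onto the chart ring of the
blow-up of the hypersurface `R/(F)` is `(F′)`. [cite: GortzWedhorn2020, Prop. 13.96 (2) and p. 416] -/
theorem ker_mapQuotient_eq_span_controlledTransform (hx : IsQuasiRegular x)
    [IsDomain (R ⧸ Ideal.span (Set.range x))] (hji : j ≠ i) {u F : R}
    (hu : u ∉ Ideal.span (Set.range x))
    (hF : F - u * x j ^ 2 ∈ Ideal.span (Set.range x) ^ 3)
    {F' : blowupAlgebra (Ideal.span (Set.range x)) (x i)}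
    (hF' : algebraMap R _ F = algebraMap R _ (x i) ^ 2 * F') :
    RingHom.ker (blowupAlgebra.mapQuotient (Ideal.span (Set.range x)) (x i) (Ideal.span {F})) =
      Ideal.span {F'} :=
  blowupAlgebra.ker_mapQuotient_eq_span (Ideal.span (Set.range x)) (x i) hF'
    (prime_algebraMap_of_isQuasiRegular x i hx) (not_dvd_controlledTransform x i j hx hji hu hF hF')

/-- **H-CONE: the exceptional line of a doubled-plane tangent cone lies on the strict transform.**
Let `I = (x₁, …, x_r) ⊆ R` be generated by a quasi-regular sequence with `R/I` a domain (e.g. the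
maximal ideal of a regular local ring with a regular system of parameters), `i ≠ j`, and let `F ∈ R`
have tangent cone the doubled hyperplane `x_j = 0` of the normal space: `F - u·x_j² ∈ I³` with
`u ∉ I`. Then on the chart `Spec R[I/xᵢ]` of the blow-up of `Spec R` along `V(I)`, the strict transform
of the hypersurface `V(F)` — the closed subscheme cut out by the kernel of
`R[I/xᵢ] → (R/(F))[Ī/x̄ᵢ]` — contains the exceptional line `e_j = V(xᵢ, x_j/xᵢ)` of the carrier
`{x_j = 0}`: `ker ⊆ (x_j/xᵢ, xᵢ)`. [OURS · L1 W4.5b; folklore-level chart algebra]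
[cite: GortzWedhorn2020, Prop. 13.96 (2) and p. 416] -/
theorem exceptionalLine_subset_strictTransform_of_doubledPlaneCone (hx : IsQuasiRegular x)
    [IsDomain (R ⧸ Ideal.span (Set.range x))] (hji : j ≠ i) {u F : R}
    (hu : u ∉ Ideal.span (Set.range x))
    (hF : F - u * x j ^ 2 ∈ Ideal.span (Set.range x) ^ 3) :
    RingHom.ker (blowupAlgebra.mapQuotient (Ideal.span (Set.range x)) (x i) (Ideal.span {F})) ≤
      Ideal.span {blowupAlgebra.frac x i j,
        algebraMap R (blowupAlgebra (Ideal.span (Set.range x)) (x i)) (x i)} := by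
  obtain ⟨F', hF', -⟩ := exists_controlledTransform_doubledPlaneCone (Ideal.span (Set.range x)) (x i)
    (blowupAlgebra.mem_span_range x j) hF
  rw [ker_mapQuotient_eq_span_controlledTransform x i j hx hji hu hF hF']
  exact exceptionalLine_le_controlledTransform (Ideal.span (Set.range x)) (x i)
    (blowupAlgebra.mem_span_range x j) hF hF'

/-- **… with multiplicity two**: under the same hypotheses and `u` a unit, the kernel `(F′)` of the chart
map together with the exceptional equation `xᵢ` generates `((x_j/xᵢ)², xᵢ)` — the trace of the strict
transform on the exceptional divisor of the chart is the doubled line `2 e_j`. [OURS · L1 W4.5b]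
[cite: GortzWedhorn2020, Prop. 13.96 (2) and p. 416] -/
theorem strictTransform_sup_exceptional_eq_doubledLine (hx : IsQuasiRegular x)
    [IsDomain (R ⧸ Ideal.span (Set.range x))] (hji : j ≠ i) {u F : R} (hunit : IsUnit u)
    (hu : u ∉ Ideal.span (Set.range x))
    (hF : F - u * x j ^ 2 ∈ Ideal.span (Set.range x) ^ 3) :
    RingHom.ker (blowupAlgebra.mapQuotient (Ideal.span (Set.range x)) (x i) (Ideal.span {F})) ⊔
        Ideal.span {algebraMap R (blowupAlgebra (Ideal.span (Set.range x)) (x i)) (x i)} =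
      Ideal.span {blowupAlgebra.frac x i j ^ 2,
        algebraMap R (blowupAlgebra (Ideal.span (Set.range x)) (x i)) (x i)} := by
  obtain ⟨F', hF', -⟩ := exists_controlledTransform_doubledPlaneCone (Ideal.span (Set.range x)) (x i)
    (blowupAlgebra.mem_span_range x j) hF
  rw [ker_mapQuotient_eq_span_controlledTransform x i j hx hji hu hF hF', ← Ideal.span_union,
    Set.singleton_union]
  exact controlledTransform_sup_exceptional_eq (Ideal.span (Set.range x)) (x i)
    (blowupAlgebra.mem_span_range x j) hunit hF hF'

end QuasiRegular

/-! ## At a closed point of a regular scheme: the centre is the maximal ideal -/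

/-- **H-CONE at a regular point.** Let `(R, 𝔪)` be a regular local ring with regular system of
parameters `x₁, …, x_d` (`(x) = 𝔪`, `d = emb dim R`), `i ≠ j`, and `F ∈ R` with
`F - u·x_j² ∈ 𝔪³`, `u` a unit — the tangent cone of the hypersurface `V(F)` at the closed point is the
DOUBLED hyperplane `{x_j = 0}`. Then on the chart `Spec R[𝔪/xᵢ]` of the blow-up of the closed point the
strict transform of `V(F)` (cut out by the kernel of `R[𝔪/xᵢ] → (R/(F))[𝔪̄/x̄ᵢ]`) contains the
exceptional line `e_j = V(xᵢ, x_j/xᵢ)` of the carrier `{x_j = 0}`, and its trace on the exceptional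
divisor `V(xᵢ)` is the doubled line: `ker + (xᵢ) = ((x_j/xᵢ)², xᵢ)` («`e_j ⊂ H_i` and `H_i ∩ E_j = 2e_j`»,
CRUX-PLAN v3 §1.7). A regular system of parameters is quasi-regular (Matsumura Thm. 16.2 (i)) and
`R/𝔪` is a field, so the quasi-regular statements apply. [OURS · L1 W4.5b]
[cite: Matsumura1987, Thm. 16.2 (i)] -/
theorem exceptionalLine_subset_strictTransform_of_doubledPlaneCone_rsop [IsRegularLocalRing R] {d : ℕ}
    (hd : (IsLocalRing.maximalIdeal R).spanFinrank = d) (x : Fin d → R)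
    (hx𝔪 : Ideal.span (Set.range x) = IsLocalRing.maximalIdeal R) (i j : Fin d) (hji : j ≠ i)
    {u F : R} (hu : IsUnit u) (hF : F - u * x j ^ 2 ∈ IsLocalRing.maximalIdeal R ^ 3) :
    RingHom.ker (blowupAlgebra.mapQuotient (Ideal.span (Set.range x)) (x i) (Ideal.span {F})) ≤
        Ideal.span {blowupAlgebra.frac x i j,
          algebraMap R (blowupAlgebra (Ideal.span (Set.range x)) (x i)) (x i)} ∧
      RingHom.ker (blowupAlgebra.mapQuotient (Ideal.span (Set.range x)) (x i) (Ideal.span {F})) ⊔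
          Ideal.span {algebraMap R (blowupAlgebra (Ideal.span (Set.range x)) (x i)) (x i)} =
        Ideal.span {blowupAlgebra.frac x i j ^ 2,
          algebraMap R (blowupAlgebra (Ideal.span (Set.range x)) (x i)) (x i)} := by
  have hx : IsQuasiRegular x := isQuasiRegular_rsop_comp hd x hx𝔪 id Function.injective_id
  haveI : IsDomain (R ⧸ Ideal.span (Set.range x)) := by
    rw [Ideal.Quotient.isDomain_iff_prime, hx𝔪]
    exact (IsLocalRing.maximalIdeal.isMaximal R).isPrime
  have hu' : u ∉ Ideal.span (Set.range x) := by
    rw [hx𝔪]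
    exact fun h => (IsLocalRing.mem_maximalIdeal u).mp h hu
  have hF' : F - u * x j ^ 2 ∈ Ideal.span (Set.range x) ^ 3 := by rwa [hx𝔪]
  exact ⟨exceptionalLine_subset_strictTransform_of_doubledPlaneCone x i j hx hji hu' hF',
    strictTransform_sup_exceptional_eq_doubledLine x i j hx hji hu hu' hF'⟩

end Summit.ResolutionOfSingularities.ResolutionOfSingularities.Cruxes.EquisingularLiftNat.Sections

end
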